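import Literature.Analysis.FluidPDE.FluidComputer.GalerkinUniqueness

/-!
# Continuous dependence on the data for the Galerkin system (Gronwall): a perturbation of the state grows at most like `e^{K(t-t₀)}` with `K` depending on the mask, the viscosity and the energy only

HONEST FRAMING (cell `pub-fluidc`, verbatim): *low prior, high value-of-information experiment on
Tao's machine paradigm; NOT a claim that NS blows up.* The object is the finite Galerkin system on a mode
set `S` (`GalerkinEnergyBalance.IsGalerkinSolution`), i.e. what a dealiased pseudo-spectral code integrates
in exact arithmetic; nothing is said about the Navier–Stokes PDE.

`GalerkinUniqueness` proved that a supported Galerkin solution is an integral curve of the `C¹` field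
`GalerkinODE.vf` on the finite-dimensional phase space `↥S → ℂ³`, Lipschitz on every ball uniformly in the
forcing (`exists_lipschitzOnWith_vf`), and deduced UNIQUENESS; its docstring lists "continuous dependence"
as not covered. This file supplies it — the third leg of well-posedness for the truncated system — in the
three forms the cell's engines meet:

* `dist_restrict_le` — **two exact solutions** (same `ν`, same forcing, ANY pressure multipliers) whose
  phase-space points stay in the ball of radius `R` on `[t₀, t₁)`:
  `‖U(t) − V(t)‖ ≤ ‖U(t₀) − V(t₀)‖ · exp(K_{S,ν,R} (t − t₀))` on `[t₀, t₁]`, with the modulus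
  `K_{S,ν,R} = galerkinLipConst S ν R` depending on the mask, the viscosity and the radius ONLY (Gronwall; the
  "fundamental lemma" [cite: HairerNorsettWanner1993, Thm. I.10.2 (10.14)] with defect `ε = 0`, Mathlib's
  `dist_le_of_trajectories_ODE_of_mem`);
* `dist_restrict_le_of_approx` — **an exact solution against an APPROXIMATE trajectory** `W` of the same field
  with defect `‖W′ − vf(W)‖ ≤ ε` (a time-stepped / rounded computation is such a `W` between its own grid
  times, with `ε` its local defect): `‖U(t) − W(t)‖ ≤ δ e^{K(t−t₀)} + (ε/K)(e^{K(t−t₀)} − 1)`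
  (`gronwallBound`, [cite: HairerNorsettWanner1993, Thm. I.10.2 (10.14)] verbatim);
* `dist_restrict_le_of_energy_le` / `dist_coeff_le_of_energy_le` — **the unforced (Euler `ν = 0` or
  Navier–Stokes `ν > 0`) case needs no ball hypothesis forward in time**: the energy is non-increasing
  (`truncEnergy_antitone`) and controls the sup norm of the state (`norm_restrict_le_sqrt`:
  `‖û‖_∞ ≤ √(2 E_S)`), so two unforced supported solutions with energies `≤ E₀` at `t₀` satisfy, for every
  `t ≥ t₀` and every coefficient, `|û(k,t)_j − v̂(k,t)_j| ≤ δ · exp(K_{S,ν,√(2E₀)} (t − t₀))` whenever all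
  coefficients differ by at most `δ` at `t₀`.

Reading for the cell (information, not a ruling): a checkpoint perturbation of size `δ` at `t₁` (e.g. an
`f32` state re-read in `f64`) moves the exact Galerkin trajectory at `t > t₁` by at most `δ e^{K(t−t₁)}`, and
a computation with local defect `ε` stays within `gronwallBound δ K ε (t − t₁)` of it, with ONE modulus `K`
fixed by `(S, ν, E(t₁))` — the structure behind "re-run only the last part of the window at higher precision";
the modulus itself is the pessimistic global Lipschitz constant (no attempt is made to evaluate it).
Standard ODE theory: [cite: HairerNorsettWanner1993, Thm. I.10.2]; for the Galerkin system
[cite: RobinsonRodrigoSadowski2016, Thm. 4.4 Step 1, p. 74] ("locally Lipschitz"), [cite: DoeringGibbon1995, §5.3].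
No named facts (D-0026); 0 sorry.
-/

noncomputable section

namespace Literature.Analysis.FluidPDE.FluidComputer

open Complex ComplexConjugate Finset Metric Set
open scoped BigOperators NNReal

namespace ShellTransfer

namespace GalerkinODE

variable (S : Finset (Fin 3 → ℤ))

/-! ## The modulus `K_{S,ν,R}` -/

/-- **The Lipschitz modulus of the Galerkin field on the ball of radius `R`** — a constant depending on the
mask `S`, the viscosity `ν` and the radius `R` only (chosen once from `exists_lipschitzOnWith_vf`; not
evaluated). [cite: RobinsonRodrigoSadowski2016, Thm. 4.4 Step 1] -/
def galerkinLipConst (ν R : ℝ) : ℝ≥0 :=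
  (exists_lipschitzOnWith_vf S ν R).choose

/-- The defining property: `vf ν g` is `K_{S,ν,R}`-Lipschitz on `closedBall 0 R`, for EVERY forcing `g`.
[cite: RobinsonRodrigoSadowski2016, Thm. 4.4 Step 1] -/
theorem lipschitzOnWith_galerkinLipConst (ν R : ℝ) (g : (Fin 3 → ℤ) → Fin 3 → ℂ) :
    LipschitzOnWith (galerkinLipConst S ν R) (vf S ν g) (closedBall 0 R) :=
  (exists_lipschitzOnWith_vf S ν R).choose_spec g

/-! ## The energy controls the phase-space norm -/

/-- Each coefficient is bounded by the energy on any mask containing its wavevector: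
`|û(k)_j| ≤ √(2 E_S)` for `k ∈ S`. [folklore] -/
theorem norm_coeff_le_sqrt (A : FourierVelocity) {k : Fin 3 → ℤ} (hk : k ∈ S) (j : Fin 3) :
    ‖A.coeff k j‖ ≤ Real.sqrt (2 * truncEnergy A S) := by
  have h1 : ‖A.coeff k j‖ ^ 2 ≤ 2 * modalEnergy A k := by
    unfold modalEnergy
    rw [← Complex.normSq_eq_norm_sq]
    have := Finset.single_le_sum (f := fun i => Complex.normSq (A.coeff k i)) (fun i _ => Complex.normSq_nonneg _)
      (Finset.mem_univ j)
    linarith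
  have h2 : modalEnergy A k ≤ truncEnergy A S :=
    Finset.single_le_sum (f := fun p => modalEnergy A p) (fun p _ => modalEnergy_nonneg A p) hk
  exact Real.le_sqrt_of_sq_le (by linarith)

/-- **`‖restrict S A‖ ≤ √(2 E_S(A))`**: the sup norm of the phase-space point is controlled by the energy on
the mask (no support hypothesis needed — both sides only see `S`). [folklore] -/
theorem norm_restrict_le_sqrt (A : FourierVelocity) : ‖restrict S A‖ ≤ Real.sqrt (2 * truncEnergy A S) := by
  refine (pi_norm_le_iff_of_nonneg (Real.sqrt_nonneg _)).2 fun k => ?_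
  refine (pi_norm_le_iff_of_nonneg (Real.sqrt_nonneg _)).2 fun j => ?_
  exact norm_coeff_le_sqrt S A k.2 j

/-- Coefficient distances are bounded by the phase-space distance. [folklore] -/
theorem dist_coeff_le_dist_restrict (A B : FourierVelocity) {k : Fin 3 → ℤ} (hk : k ∈ S) (j : Fin 3) :
    dist (A.coeff k j) (B.coeff k j) ≤ dist (restrict S A) (restrict S B) := by
  have h1 := dist_le_pi_dist (restrict S A) (restrict S B) ⟨k, hk⟩
  have h2 := dist_le_pi_dist (restrict S A ⟨k, hk⟩) (restrict S B ⟨k, hk⟩) j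
  exact h2.trans h1

/-- Conversely the phase-space distance is at most `δ` when every coefficient distance on `S` is. [folklore] -/
theorem dist_restrict_le_of_coeff {A B : FourierVelocity} {δ : ℝ} (hδ : 0 ≤ δ)
    (h : ∀ k ∈ S, ∀ j, dist (A.coeff k j) (B.coeff k j) ≤ δ) :
    dist (restrict S A) (restrict S B) ≤ δ := by
  refine (dist_pi_le_iff hδ).2 fun k => ?_
  refine (dist_pi_le_iff hδ).2 fun j => ?_
  exact h k k.2 j

/-! ## Continuous dependence in a ball (any forcing, any pressures) -/

/-- **CONTINUOUS DEPENDENCE ON THE DATA, ball form.** Two Galerkin solutions on `S` with the same viscosity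
and forcing (arbitrary pressure multipliers), supported in `S`, whose states have sup norm `≤ R` on
`[t₀, t₁)`, separate at most exponentially with the modulus `K_{S,ν,R}`:
`‖U(t) − V(t)‖ ≤ ‖U(t₀) − V(t₀)‖ e^{K(t−t₀)}` on `[t₀, t₁]`.
[cite: HairerNorsettWanner1993, Thm. I.10.2 (10.14)] (`ε = 0`) -/
theorem dist_restrict_le {U V : ℝ → FourierVelocity} {ν : ℝ} {c c' : ℝ → (Fin 3 → ℤ) → ℂ}
    {f : ℝ → (Fin 3 → ℤ) → Fin 3 → ℂ} (hU : IsGalerkinSolution U S ν c f)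
    (hV : IsGalerkinSolution V S ν c' f) (hsU : IsSupportedOn U S) (hsV : IsSupportedOn V S)
    {t₀ t₁ R : ℝ} (hRU : ∀ s ∈ Ico t₀ t₁, ‖restrict S (U s)‖ ≤ R)
    (hRV : ∀ s ∈ Ico t₀ t₁, ‖restrict S (V s)‖ ≤ R) {t : ℝ} (ht : t ∈ Icc t₀ t₁) :
    dist (restrict S (U t)) (restrict S (V t)) ≤
      dist (restrict S (U t₀)) (restrict S (V t₀)) * Real.exp (galerkinLipConst S ν R * (t - t₀)) := by
  have hFd : ∀ s, HasDerivAt (fun s => restrict S (U s)) (vf S ν (f s) (restrict S (U s))) s :=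
    fun s => hasDerivAt_restrict S hU hsU s
  have hGd : ∀ s, HasDerivAt (fun s => restrict S (V s)) (vf S ν (f s) (restrict S (V s))) s :=
    fun s => hasDerivAt_restrict S hV hsV s
  have hFc : Continuous fun s => restrict S (U s) :=
    continuous_iff_continuousAt.2 fun s => (hFd s).continuousAt
  have hGc : Continuous fun s => restrict S (V s) :=
    continuous_iff_continuousAt.2 fun s => (hGd s).continuousAt
  exact dist_le_of_trajectories_ODE_of_mem (v := fun s x => vf S ν (f s) x) (s := fun _ => closedBall 0 R)
    (fun s _ => lipschitzOnWith_galerkinLipConst S ν R (f s)) hFc.continuousOn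
    (fun s _ => (hFd s).hasDerivWithinAt)
    (fun s hs => by rw [mem_closedBall, dist_zero_right]; exact hRU s hs) hGc.continuousOn
    (fun s _ => (hGd s).hasDerivWithinAt)
    (fun s hs => by rw [mem_closedBall, dist_zero_right]; exact hRV s hs) le_rfl t ht

/-! ## An exact solution against an approximate trajectory (defect form) -/

/-- **DEFECT FORM (the "fundamental lemma" verbatim).** `U` an exact supported Galerkin solution, `W` any
phase-space curve with derivative `W′` whose DEFECT against the same field is `≤ ε` on `[t₀, t₁)`
(`‖W′(s) − vf(f(s))(W(s))‖ ≤ ε`), both of sup norm `≤ R` there, and `‖U(t₀) − W(t₀)‖ ≤ δ`. Then on `[t₀, t₁]`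
`‖U(t) − W(t)‖ ≤ gronwallBound δ K ε (t − t₀) = δ e^{K(t−t₀)} + (ε/K)(e^{K(t−t₀)} − 1)`, `K = K_{S,ν,R}`.
[cite: HairerNorsettWanner1993, Thm. I.10.2 (10.14)] -/
theorem dist_restrict_le_of_approx {U : ℝ → FourierVelocity} {ν : ℝ} {c : ℝ → (Fin 3 → ℤ) → ℂ}
    {f : ℝ → (Fin 3 → ℤ) → Fin 3 → ℂ} (hU : IsGalerkinSolution U S ν c f) (hsU : IsSupportedOn U S)
    {W W' : ℝ → ↥S → Fin 3 → ℂ} {t₀ t₁ R δ ε : ℝ} (hW : ContinuousOn W (Icc t₀ t₁))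
    (hW' : ∀ s ∈ Ico t₀ t₁, HasDerivWithinAt W (W' s) (Ici s) s)
    (hdef : ∀ s ∈ Ico t₀ t₁, dist (W' s) (vf S ν (f s) (W s)) ≤ ε)
    (hRU : ∀ s ∈ Ico t₀ t₁, ‖restrict S (U s)‖ ≤ R) (hRW : ∀ s ∈ Ico t₀ t₁, ‖W s‖ ≤ R)
    (h0 : dist (restrict S (U t₀)) (W t₀) ≤ δ) {t : ℝ} (ht : t ∈ Icc t₀ t₁) :
    dist (restrict S (U t)) (W t) ≤ gronwallBound δ (galerkinLipConst S ν R) ε (t - t₀) := by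
  have hFd : ∀ s, HasDerivAt (fun s => restrict S (U s)) (vf S ν (f s) (restrict S (U s))) s :=
    fun s => hasDerivAt_restrict S hU hsU s
  have hFc : Continuous fun s => restrict S (U s) :=
    continuous_iff_continuousAt.2 fun s => (hFd s).continuousAt
  have h := dist_le_of_approx_trajectories_ODE_of_mem (v := fun s x => vf S ν (f s) x)
    (s := fun _ => closedBall 0 R) (f' := fun s => vf S ν (f s) (restrict S (U s)))
    (fun s _ => lipschitzOnWith_galerkinLipConst S ν R (f s)) hFc.continuousOn
    (fun s _ => (hFd s).hasDerivWithinAt) (fun s _ => by rw [dist_self])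
    (fun s hs => by rw [mem_closedBall, dist_zero_right]; exact hRU s hs) hW hW' hdef
    (fun s hs => by rw [mem_closedBall, dist_zero_right]; exact hRW s hs) h0 t ht
  rwa [zero_add] at h

/-! ## The unforced case: the energy ball is invariant forward in time -/

/-- Forward in time an unforced Galerkin solution with `ν ≥ 0` stays in the ball of radius `√(2E₀)`,
`E₀ ≥ E_S(t₀)`. [folklore] -/
theorem norm_restrict_le_of_energy_le {U : ℝ → FourierVelocity} {ν : ℝ} (hν : 0 ≤ ν)
    {c : ℝ → (Fin 3 → ℤ) → ℂ} (hU : IsGalerkinSolution U S ν c fun _ _ _ => 0) {t₀ E₀ : ℝ}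
    (hE : truncEnergy (U t₀) S ≤ E₀) {s : ℝ} (hs : t₀ ≤ s) :
    ‖restrict S (U s)‖ ≤ Real.sqrt (2 * E₀) := by
  have h1 := norm_restrict_le_sqrt S (U s)
  have h2 : truncEnergy (U s) S ≤ truncEnergy (U t₀) S := truncEnergy_antitone hν hU hs
  exact h1.trans (Real.sqrt_le_sqrt (by linarith))

/-- **CONTINUOUS DEPENDENCE FOR UNFORCED GALERKIN EULER / NAVIER–STOKES, no ball hypothesis.** Two unforced
solutions on `S` (`ν ≥ 0`, any pressure multipliers), supported in `S`, with energies `≤ E₀` at `t₀`: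
for every `t ≥ t₀`, `‖U(t) − V(t)‖ ≤ ‖U(t₀) − V(t₀)‖ · exp(K_{S,ν,√(2E₀)} (t − t₀))`.
[cite: HairerNorsettWanner1993, Thm. I.10.2] [cite: DoeringGibbon1995, §5.3] -/
theorem dist_restrict_le_of_energy_le {U V : ℝ → FourierVelocity} {ν : ℝ} (hν : 0 ≤ ν)
    {c c' : ℝ → (Fin 3 → ℤ) → ℂ} (hU : IsGalerkinSolution U S ν c fun _ _ _ => 0)
    (hV : IsGalerkinSolution V S ν c' fun _ _ _ => 0) (hsU : IsSupportedOn U S) (hsV : IsSupportedOn V S)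
    {t₀ E₀ : ℝ} (hEU : truncEnergy (U t₀) S ≤ E₀) (hEV : truncEnergy (V t₀) S ≤ E₀) {t : ℝ} (ht : t₀ ≤ t) :
    dist (restrict S (U t)) (restrict S (V t)) ≤
      dist (restrict S (U t₀)) (restrict S (V t₀)) * Real.exp (galerkinLipConst S ν (Real.sqrt (2 * E₀)) * (t - t₀)) :=
  dist_restrict_le S hU hV hsU hsV (t₁ := t)
    (fun _ hs => norm_restrict_le_of_energy_le S hν hU hEU hs.1)
    (fun _ hs => norm_restrict_le_of_energy_le S hν hV hEV hs.1) ⟨ht, le_rfl⟩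

/-- **Coefficientwise reading.** If at `t₀` every Fourier coefficient of two unforced supported Galerkin
solutions (energies `≤ E₀`, `ν ≥ 0`) differs by at most `δ`, then at every later time every coefficient differs
by at most `δ · exp(K_{S,ν,√(2E₀)} (t − t₀))`. [folklore] -/
theorem dist_coeff_le_of_energy_le {U V : ℝ → FourierVelocity} {ν : ℝ} (hν : 0 ≤ ν)
    {c c' : ℝ → (Fin 3 → ℤ) → ℂ} (hU : IsGalerkinSolution U S ν c fun _ _ _ => 0)
    (hV : IsGalerkinSolution V S ν c' fun _ _ _ => 0) (hsU : IsSupportedOn U S) (hsV : IsSupportedOn V S)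
    {t₀ E₀ δ : ℝ} (hEU : truncEnergy (U t₀) S ≤ E₀) (hEV : truncEnergy (V t₀) S ≤ E₀) (hδ : 0 ≤ δ)
    (h0 : ∀ k ∈ S, ∀ j, dist ((U t₀).coeff k j) ((V t₀).coeff k j) ≤ δ) {t : ℝ} (ht : t₀ ≤ t)
    {k : Fin 3 → ℤ} (hk : k ∈ S) (j : Fin 3) :
    dist ((U t).coeff k j) ((V t).coeff k j) ≤ δ * Real.exp (galerkinLipConst S ν (Real.sqrt (2 * E₀)) * (t - t₀)) := by
  have h1 := dist_coeff_le_dist_restrict S (U t) (V t) hk j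
  have h2 := dist_restrict_le_of_energy_le S hν hU hV hsU hsV hEU hEV ht
  have h3 := dist_restrict_le_of_coeff S hδ h0
  have h4 : 0 ≤ Real.exp (galerkinLipConst S ν (Real.sqrt (2 * E₀)) * (t - t₀)) := (Real.exp_pos _).le
  calc dist ((U t).coeff k j) ((V t).coeff k j) ≤ _ := h1.trans h2
    _ ≤ δ * Real.exp (galerkinLipConst S ν (Real.sqrt (2 * E₀)) * (t - t₀)) := mul_le_mul_of_nonneg_right h3 h4

/-- Off the mask nothing happens: both solutions vanish there, so the coefficientwise bound holds for every
wavevector. [folklore] -/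
theorem dist_coeff_le_of_energy_le' {U V : ℝ → FourierVelocity} {ν : ℝ} (hν : 0 ≤ ν)
    {c c' : ℝ → (Fin 3 → ℤ) → ℂ} (hU : IsGalerkinSolution U S ν c fun _ _ _ => 0)
    (hV : IsGalerkinSolution V S ν c' fun _ _ _ => 0) (hsU : IsSupportedOn U S) (hsV : IsSupportedOn V S)
    {t₀ E₀ δ : ℝ} (hEU : truncEnergy (U t₀) S ≤ E₀) (hEV : truncEnergy (V t₀) S ≤ E₀) (hδ : 0 ≤ δ)
    (h0 : ∀ k ∈ S, ∀ j, dist ((U t₀).coeff k j) ((V t₀).coeff k j) ≤ δ) {t : ℝ} (ht : t₀ ≤ t)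
    (k : Fin 3 → ℤ) (j : Fin 3) :
    dist ((U t).coeff k j) ((V t).coeff k j) ≤ δ * Real.exp (galerkinLipConst S ν (Real.sqrt (2 * E₀)) * (t - t₀)) := by
  by_cases hk : k ∈ S
  · exact dist_coeff_le_of_energy_le S hν hU hV hsU hsV hEU hEV hδ h0 ht hk j
  · rw [hsU t k hk, hsV t k hk, dist_self]
    exact mul_nonneg hδ (Real.exp_pos _).le

/-- **Uniqueness recovered** as the `δ = 0` case (consistency check with `galerkin_unique`, forward in time,
unforced). [folklore] -/
theorem eq_of_energy_le {U V : ℝ → FourierVelocity} {ν : ℝ} (hν : 0 ≤ ν)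
    {c c' : ℝ → (Fin 3 → ℤ) → ℂ} (hU : IsGalerkinSolution U S ν c fun _ _ _ => 0)
    (hV : IsGalerkinSolution V S ν c' fun _ _ _ => 0) (hsU : IsSupportedOn U S) (hsV : IsSupportedOn V S)
    {t₀ : ℝ} (h0 : U t₀ = V t₀) {t : ℝ} (ht : t₀ ≤ t) : U t = V t := by
  refine TaylorGreenHat.fourierVelocity_ext ?_
  funext k j
  have h := dist_coeff_le_of_energy_le' S hν hU hV hsU hsV (E₀ := truncEnergy (U t₀) S) le_rfl
    (by rw [← h0]) le_rfl (fun k _ j => by rw [h0, dist_self]) ht k j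
  rw [zero_mul] at h
  exact dist_le_zero.1 h

end GalerkinODE

end ShellTransfer

end Literature.Analysis.FluidPDE.FluidComputer

end
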